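/-
Copyright (c) 2026 the pub-hodgecm-mathlib formalisation cell (harness21).  Prover seat hodgecm-mathlib-F0P2-p01 (g14), 2026-09-01.  Road «S3-tree», organ (I) piece N3
(architect A-p16 (g30) A-139): the residual algebra of the Cayley∕Möbius shift — the level-1 INTERIOR stratum of `z` (rank of the residual nilpotent `red(c⁻¹(z − 1))`) is the
residually-unipotent stratum of `φ_c(z)` (rank of `red(φ_c(z)) − 1`).
-/
import Literature.NumberTheory.Automorphic.ResiduallyTrivialFixedCosetCount   -- ★ A-p12: `redMat` API (`redMat_mul/add/sub/smul/one`, `red_det`, `rank_eq_zero_iff_eq_zero`, …); brings ★ `IntegralMatrixReduction`, `GLnCongruenceSubgroups` (`ValBound`)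
import Mathlib.LinearAlgebra.Matrix.Charpoly.LinearMap
import HarnessLib

/-!
# Residual algebra of the Möbius shift: `red(φ_c(1 + cA)) − 1 = 2Ā(2 − Ā)⁻¹` — nilpotency and rank are kept (road «S3-tree», organ (I) N3; Kottwitz 1986 §3, Rogawski 1990 §4.9)

Topic `NumberTheory/Automorphic`; namespace `Literature.NumberTheory.Automorphic`.  THEOREMS ONLY (no definition, no instance, no notation, no named fact, no `sorry`); generic
`[Field F] [ValuativeRel F]`, any size `n`.  Cell `pub/hodgecm-mathlib` (D-0151), crux H413 = `stmt-HodgeConjecture-24833`; road «S3-tree» (architect A-p16 (g30) A-139: organ (I)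
`stub_liftInterior` split N1…N6; this is the algebra under N3 «`hF`: `Φ(⟦x⟧, 1_{≡1(ϖ)}·g) = Φ(⟦φ_c x⟧, g′)`», consumer F0P2-p02 (g11) N6).  Seat F0P2-p01 (g14).
HONEST LABEL: HC_CM is proved only modulo the 2 remaining named inputs (hLiu418 24832, h413 24833) until rung 0 closes; nothing printed is asserted here.

THE MATHEMATICS.  `F` a valued field, `𝒪` its valuation ring, `𝓀` the residue field, `red : M_n(𝒪) → M_n(𝓀)`; `c ∈ 𝒪` with `|c| < 1`, `|2| = 1`.  Let `z = 1 + cA` with `A`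
integral and `Ā := red A` NILPOTENT (the level-1 interior: `z ≡ 1 (mod c)` with residual nilpotent `Ā`).  The Möbius shift with parameter `c` is
`φ_c(z) = ((c+1)z + (c−1))((c−1)z + (c+1))⁻¹ = (2 + (c+1)A)(2 + (c−1)A)⁻¹` (★ α `moebius_one_add_smul_eq`).  Then:
* §1 `red(2·1 + tA) = 2·1 + red(t)·Ā` and `det(2·1 + tA)` is a UNIT for integral `t` (its reduction is `det(2·1 + t̄Ā) = det(2(1 + nilpotent)) ≠ 0`);
* §2 if `M(2·1 + (c−1)A) = 2·1 + (c+1)A` with `M` integral (i.e. `M = φ_c(z)`), then `red M · (2 − Ā) = 2 + Ā`, so **`red M − 1 = 2Ā(2 − Ā)⁻¹`**: `(red M − 1)^k = 0` whenever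
  `Ā^k = 0`, and **`rank(red M − 1) = rank Ā`** — the residual Jordan stratum of the shift `φ_c(z)` (a residually-unipotent element) IS the interior stratum of `z`;
* §3 the source of nilpotency: if `A` is integral and `charpoly A = charpoly W` for an integral `W ≡ 0 (mod 𝔪)` (e.g. `A` conjugate over `F` to `W = c⁻¹(ι − 1)` with `ι ≡ 1 (c²)`),
  then `charpoly(Ā) = T^n` and `Ā^n = 0` (Cayley–Hamilton); and a nilpotent `n × n` matrix over a field has `rank < n` (`n ≥ 1`).

## References
* [Kottwitz1986] R. E. Kottwitz, *Base change for unit elements of Hecke algebras*, Compositio Math. 60 (1986), §3 (the shift on fixed lattices).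
* [Rogawski1990] J. D. Rogawski, *Automorphic Representations of Unitary Groups in Three Variables*, Ann. of Math. Stud. 123 (1990), §4.9 Prop. 4.9.1 p. 55, §3.9 p. 32.
* [Serre1980Trees] J.-P. Serre, *Trees* (1980), Ch. II §1.1–1.2.
-/

set_option autoImplicit false

noncomputable section

open scoped Matrix MatrixGroups ValuativeRel Polynomial
open Matrix ValuativeRel Polynomial

namespace Literature.NumberTheory.Automorphic

open Literature.NumberTheory.Automorphic.IntegralReduction

variable {F : Type*} [Field F] [ValuativeRel F] {n : ℕ}

/-! ## §1 Reduction of `2·1 + tA` and its unit determinant -/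

/-- An element of valuation `< 1` reduces to `0`. [cite: Serre1980Trees, Ch. II §1.1–1.2] -/
theorem red_eq_zero_of_valuation_lt_one {x : F} (hx : valuation F x < 1) : red x = 0 := by
  by_contra h
  exact hx.ne (valuation_eq_one_of_red_ne_zero ((Valuation.mem_integer_iff _ _).2 hx.le) h)

/-- `red (2·1 + t·A) = 2·1 + red t · red A` for integral `A`, `t`. [cite: Kottwitz1986, §3] -/
theorem redMat_two_smul_one_add_smul {A : Matrix (Fin n) (Fin n) F} (hA : ValBound 1 A) {t : F} (ht : valuation F t ≤ 1) :
    redMat ((2 : F) • (1 : Matrix (Fin n) (Fin n) F) + t • A) = (2 : 𝓀[F]) • (1 : Matrix (Fin n) (Fin n) 𝓀[F]) + red t • redMat A := by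
  have h2 : (2 : F) ∈ 𝒪[F] := ofNat_mem _ 2
  have htO : t ∈ 𝒪[F] := (Valuation.mem_integer_iff _ _).2 ht
  have hb1 : ValBound 1 ((2 : F) • (1 : Matrix (Fin n) (Fin n) F)) := fun i j => by
    rw [Matrix.smul_apply, smul_eq_mul, map_mul]
    exact mul_le_one' ((Valuation.mem_integer_iff _ _).1 h2) (valBound_one i j)
  have hb2 : ValBound 1 (t • A) := fun i j => by
    rw [Matrix.smul_apply, smul_eq_mul, map_mul]
    exact mul_le_one' ht (hA i j)
  rw [redMat_add hb1 hb2, redMat_smul h2 valBound_one, redMat_smul htO hA, redMat_one, red_two]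

/-- `2·1 + s·N` is a unit for nilpotent `N` when `2 ≠ 0` in the residue field. [cite: Kottwitz1986, §3] -/
theorem isUnit_two_smul_one_add_smul_of_isNilpotent {k : Type*} [Field k] {N : Matrix (Fin n) (Fin n) k} (hN : IsNilpotent N) (s : k) (h2 : (2 : k) ≠ 0) :
    IsUnit ((2 : k) • (1 : Matrix (Fin n) (Fin n) k) + s • N) := by
  have hsN : IsNilpotent (((2 : k)⁻¹ * s) • N) := by
    obtain ⟨m, hm⟩ := hN
    exact ⟨m, by rw [_root_.smul_pow, hm, smul_zero]⟩
  have h1 : IsUnit (1 + ((2 : k)⁻¹ * s) • N) := hsN.isUnit_one_add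
  have h2u : IsUnit ((2 : k) • (1 : Matrix (Fin n) (Fin n) k)) := by
    refine ⟨⟨(2 : k) • 1, (2 : k)⁻¹ • 1, ?_, ?_⟩, rfl⟩ <;>
      rw [smul_mul_smul_comm, Matrix.mul_one] <;> [rw [mul_inv_cancel₀ h2, one_smul]; rw [inv_mul_cancel₀ h2, one_smul]]
  have e : (2 : k) • (1 : Matrix (Fin n) (Fin n) k) + s • N = ((2 : k) • (1 : Matrix (Fin n) (Fin n) k)) * (1 + ((2 : k)⁻¹ * s) • N) := by
    rw [Matrix.mul_add, Matrix.mul_one, Matrix.smul_mul, Matrix.one_mul, smul_smul, ← mul_assoc, mul_inv_cancel₀ h2, one_mul]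
  rw [e]
  exact h2u.mul h1

/-- **`det(2·1 + tA)` is a unit** for integral `A` with nilpotent reduction, integral `t`, and `|2| = 1`: its reduction `det(2·1 + t̄Ā)` is non-zero. [cite: Kottwitz1986, §3] -/
theorem valuation_det_two_smul_one_add_smul_eq_one {A : Matrix (Fin n) (Fin n) F} (hA : ValBound 1 A) (hnil : IsNilpotent (redMat A)) {t : F}
    (ht : valuation F t ≤ 1) (h2 : valuation F (2 : F) = 1) :
    valuation F ((2 : F) • (1 : Matrix (Fin n) (Fin n) F) + t • A).det = 1 := by
  have hb : ValBound 1 ((2 : F) • (1 : Matrix (Fin n) (Fin n) F) + t • A) := fun i j => by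
    rw [Matrix.add_apply, Matrix.smul_apply, Matrix.smul_apply, smul_eq_mul, smul_eq_mul]
    refine Valuation.map_add_le _ ?_ ?_
    · rw [map_mul]; exact mul_le_one' h2.le (valBound_one i j)
    · rw [map_mul]; exact mul_le_one' ht (hA i j)
  refine valuation_eq_one_of_red_ne_zero ((Valuation.mem_integer_iff _ _).2 (valuation_det_le_one hb)) ?_
  rw [red_det hb, redMat_two_smul_one_add_smul hA ht]
  have h2k : (2 : 𝓀[F]) ≠ 0 := by rw [← red_two]; exact red_ne_zero_of_valuation_eq_one h2
  exact ((isUnit_two_smul_one_add_smul_of_isNilpotent hnil (red t) h2k).map Matrix.detMonoidHom).ne_zero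

/-! ## §2 The reduction of the shift: `red(φ_c z) − 1 = 2Ā(2 − Ā)⁻¹`, nilpotency and rank -/

/-- **THE RESIDUAL SHIFT**: if `M·(2·1 + (c−1)A) = 2·1 + (c+1)A` (`M = φ_c(1 + cA)`) with `M, A` integral, `|c| < 1`, then `red M · (2·1 − Ā) = 2·1 + Ā`. [cite: Kottwitz1986, §3] -/
theorem redMat_mul_two_sub_eq_two_add {M A : Matrix (Fin n) (Fin n) F} (hM : ValBound 1 M) (hA : ValBound 1 A) {c : F} (hc : valuation F c < 1)
    (hMB : M * ((2 : F) • (1 : Matrix (Fin n) (Fin n) F) + (c - 1) • A) = (2 : F) • (1 : Matrix (Fin n) (Fin n) F) + (c + 1) • A) :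
    redMat M * ((2 : 𝓀[F]) • (1 : Matrix (Fin n) (Fin n) 𝓀[F]) - redMat A) = (2 : 𝓀[F]) • (1 : Matrix (Fin n) (Fin n) 𝓀[F]) + redMat A := by
  have hc1 : valuation F c ≤ 1 := hc.le
  have hcm : valuation F (c - 1) ≤ 1 := (Valuation.map_sub _ _ _).trans (max_le hc1 (by rw [Valuation.map_one]))
  have hcp : valuation F (c + 1) ≤ 1 := (Valuation.map_add _ _ _).trans (max_le hc1 (by rw [Valuation.map_one]))
  have hB : ValBound 1 ((2 : F) • (1 : Matrix (Fin n) (Fin n) F) + (c - 1) • A) := fun i j => by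
    rw [Matrix.add_apply, Matrix.smul_apply, Matrix.smul_apply, smul_eq_mul, smul_eq_mul]
    refine Valuation.map_add_le _ ?_ ?_
    · rw [map_mul]; exact mul_le_one' ((Valuation.mem_integer_iff _ _).1 (ofNat_mem _ 2)) (valBound_one i j)
    · rw [map_mul]; exact mul_le_one' hcm (hA i j)
  have hcO : c ∈ 𝒪[F] := (Valuation.mem_integer_iff _ _).2 hc1
  have hredc : red c = 0 := red_eq_zero_of_valuation_lt_one hc
  have hredcm : red (c - 1) = -1 := by
    have e : red (c - 1) = IsLocalRing.residue 𝒪[F] ((⟨c, hcO⟩ : 𝒪[F]) - 1) := red_coe ((⟨c, hcO⟩ : 𝒪[F]) - 1)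
    have e' : red c = IsLocalRing.residue 𝒪[F] (⟨c, hcO⟩ : 𝒪[F]) := red_coe (⟨c, hcO⟩ : 𝒪[F])
    rw [e, map_sub, map_one, ← e', hredc, zero_sub]
  have hredcp : red (c + 1) = 1 := by
    have e : red (c + 1) = IsLocalRing.residue 𝒪[F] ((⟨c, hcO⟩ : 𝒪[F]) + 1) := red_coe ((⟨c, hcO⟩ : 𝒪[F]) + 1)
    have e' : red c = IsLocalRing.residue 𝒪[F] (⟨c, hcO⟩ : 𝒪[F]) := red_coe (⟨c, hcO⟩ : 𝒪[F])
    rw [e, map_add, map_one, ← e', hredc, zero_add]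
  have h := congrArg redMat hMB
  rw [redMat_mul hM hB, redMat_two_smul_one_add_smul hA hcm, redMat_two_smul_one_add_smul hA hcp, hredcm, hredcp, neg_one_smul, one_smul,
    ← sub_eq_add_neg] at h
  exact h

/-- **`red(φ_c z) − 1 = 2Ā(2·1 − Ā)⁻¹`** (`Ā = red A` nilpotent, so `2·1 − Ā` is invertible). [cite: Kottwitz1986, §3] [cite: Rogawski1990, §4.9 Prop. 4.9.1 p. 55] -/
theorem redMat_sub_one_eq_of_shift {M A : Matrix (Fin n) (Fin n) F} (hM : ValBound 1 M) (hA : ValBound 1 A) (hnil : IsNilpotent (redMat A)) {c : F}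
    (hc : valuation F c < 1) (h2 : valuation F (2 : F) = 1)
    (hMB : M * ((2 : F) • (1 : Matrix (Fin n) (Fin n) F) + (c - 1) • A) = (2 : F) • (1 : Matrix (Fin n) (Fin n) F) + (c + 1) • A) :
    redMat M - 1 = ((2 : 𝓀[F]) • redMat A) * ((2 : 𝓀[F]) • (1 : Matrix (Fin n) (Fin n) 𝓀[F]) - redMat A)⁻¹ := by
  have h2k : (2 : 𝓀[F]) ≠ 0 := by rw [← red_two]; exact red_ne_zero_of_valuation_eq_one h2
  have hD : IsUnit ((2 : 𝓀[F]) • (1 : Matrix (Fin n) (Fin n) 𝓀[F]) - redMat A) := by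
    have h := isUnit_two_smul_one_add_smul_of_isNilpotent hnil (-1) h2k
    rwa [neg_one_smul, ← sub_eq_add_neg] at h
  have hDdet : IsUnit ((2 : 𝓀[F]) • (1 : Matrix (Fin n) (Fin n) 𝓀[F]) - redMat A).det := (Matrix.isUnit_iff_isUnit_det _).1 hD
  have key := redMat_mul_two_sub_eq_two_add hM hA hc hMB
  -- `red M = (2 + Ā)(2 − Ā)⁻¹`, so `red M − 1 = ((2 + Ā) − (2 − Ā))(2 − Ā)⁻¹ = 2Ā(2 − Ā)⁻¹`
  have e1 : redMat M = ((2 : 𝓀[F]) • (1 : Matrix (Fin n) (Fin n) 𝓀[F]) + redMat A) * ((2 : 𝓀[F]) • (1 : Matrix (Fin n) (Fin n) 𝓀[F]) - redMat A)⁻¹ := by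
    rw [← key, Matrix.mul_nonsing_inv_cancel_right _ _ hDdet]
  have e2 : (1 : Matrix (Fin n) (Fin n) 𝓀[F]) = ((2 : 𝓀[F]) • (1 : Matrix (Fin n) (Fin n) 𝓀[F]) - redMat A) * ((2 : 𝓀[F]) • (1 : Matrix (Fin n) (Fin n) 𝓀[F]) - redMat A)⁻¹ := by
    rw [Matrix.mul_nonsing_inv _ hDdet]
  calc redMat M - 1 = ((2 : 𝓀[F]) • (1 : Matrix (Fin n) (Fin n) 𝓀[F]) + redMat A) * ((2 : 𝓀[F]) • (1 : Matrix (Fin n) (Fin n) 𝓀[F]) - redMat A)⁻¹ -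
      ((2 : 𝓀[F]) • (1 : Matrix (Fin n) (Fin n) 𝓀[F]) - redMat A) * ((2 : 𝓀[F]) • (1 : Matrix (Fin n) (Fin n) 𝓀[F]) - redMat A)⁻¹ := by rw [← e1, ← e2]
    _ = ((2 : 𝓀[F]) • redMat A) * ((2 : 𝓀[F]) • (1 : Matrix (Fin n) (Fin n) 𝓀[F]) - redMat A)⁻¹ := by
      rw [← Matrix.sub_mul]
      congr 1
      rw [two_smul, two_smul]
      abel

/-- **THE SHIFT KEEPS NILPOTENCY OF THE RESIDUAL CLASS**: `Ā^k = 0 ⇒ (red(φ_c z) − 1)^k = 0`. [cite: Kottwitz1986, §3] [cite: Rogawski1990, §3.9 p. 32] -/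
theorem pow_redMat_sub_one_eq_zero_of_shift {M A : Matrix (Fin n) (Fin n) F} (hM : ValBound 1 M) (hA : ValBound 1 A) {k : ℕ} (hnil : redMat A ^ k = 0) {c : F}
    (hc : valuation F c < 1) (h2 : valuation F (2 : F) = 1)
    (hMB : M * ((2 : F) • (1 : Matrix (Fin n) (Fin n) F) + (c - 1) • A) = (2 : F) • (1 : Matrix (Fin n) (Fin n) F) + (c + 1) • A) :
    (redMat M - 1) ^ k = 0 := by
  have h2k : (2 : 𝓀[F]) ≠ 0 := by rw [← red_two]; exact red_ne_zero_of_valuation_eq_one h2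
  have hD : IsUnit ((2 : 𝓀[F]) • (1 : Matrix (Fin n) (Fin n) 𝓀[F]) - redMat A) := by
    have h := isUnit_two_smul_one_add_smul_of_isNilpotent ⟨k, hnil⟩ (-1) h2k
    rwa [neg_one_smul, ← sub_eq_add_neg] at h
  obtain ⟨D, hD'⟩ := hD
  have hDdet : IsUnit ((2 : 𝓀[F]) • (1 : Matrix (Fin n) (Fin n) 𝓀[F]) - redMat A).det := (Matrix.isUnit_iff_isUnit_det _).1 ⟨D, hD'⟩
  rw [redMat_sub_one_eq_of_shift hM hA ⟨k, hnil⟩ hc h2 hMB]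
  -- `Ā` commutes with `(2 − Ā)⁻¹`
  have hcommD : Commute ((2 : 𝓀[F]) • redMat A) (D : Matrix (Fin n) (Fin n) 𝓀[F]) := by
    rw [hD']
    refine (Commute.smul_left ?_ _)
    exact ((Commute.one_right _).smul_right _).sub_right (Commute.refl _)
  have hinv : ((2 : 𝓀[F]) • (1 : Matrix (Fin n) (Fin n) 𝓀[F]) - redMat A)⁻¹ = ((D⁻¹ : (Matrix (Fin n) (Fin n) 𝓀[F])ˣ) : Matrix (Fin n) (Fin n) 𝓀[F]) := by
    rw [← hD', Matrix.coe_units_inv]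
  rw [hinv, (hcommD.units_inv_right).mul_pow, _root_.smul_pow, hnil, smul_zero, Matrix.zero_mul]

/-- **THE SHIFT KEEPS THE JORDAN RANK**: `rank(red(φ_c z) − 1) = rank Ā`. [cite: Kottwitz1986, §3] [cite: Rogawski1990, §4.9 Prop. 4.9.1 p. 55; §3.9 p. 32] -/
theorem rank_redMat_sub_one_eq_of_shift {M A : Matrix (Fin n) (Fin n) F} (hM : ValBound 1 M) (hA : ValBound 1 A) (hnil : IsNilpotent (redMat A)) {c : F}
    (hc : valuation F c < 1) (h2 : valuation F (2 : F) = 1)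
    (hMB : M * ((2 : F) • (1 : Matrix (Fin n) (Fin n) F) + (c - 1) • A) = (2 : F) • (1 : Matrix (Fin n) (Fin n) F) + (c + 1) • A) :
    (redMat M - 1).rank = (redMat A).rank := by
  have h2k : (2 : 𝓀[F]) ≠ 0 := by rw [← red_two]; exact red_ne_zero_of_valuation_eq_one h2
  have hD : IsUnit ((2 : 𝓀[F]) • (1 : Matrix (Fin n) (Fin n) 𝓀[F]) - redMat A) := by
    have h := isUnit_two_smul_one_add_smul_of_isNilpotent hnil (-1) h2k
    rwa [neg_one_smul, ← sub_eq_add_neg] at h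
  have hDdet : IsUnit ((2 : 𝓀[F]) • (1 : Matrix (Fin n) (Fin n) 𝓀[F]) - redMat A).det := (Matrix.isUnit_iff_isUnit_det _).1 hD
  have hDinv : IsUnit ((2 : 𝓀[F]) • (1 : Matrix (Fin n) (Fin n) 𝓀[F]) - redMat A)⁻¹.det := by
    exact Matrix.isUnit_nonsing_inv_det _ hDdet
  rw [redMat_sub_one_eq_of_shift hM hA hnil hc h2 hMB, Matrix.rank_mul_eq_left_of_isUnit_det _ _ hDinv]
  -- `rank (2 • Ā) = rank Ā`: `2 • Ā = (2 • 1) * Ā` with `2 • 1` invertible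
  have e : (2 : 𝓀[F]) • redMat A = ((2 : 𝓀[F]) • (1 : Matrix (Fin n) (Fin n) 𝓀[F])) * redMat A := by rw [Matrix.smul_mul, Matrix.one_mul]
  have h2det : IsUnit ((2 : 𝓀[F]) • (1 : Matrix (Fin n) (Fin n) 𝓀[F])).det := by
    rw [Matrix.det_smul, Matrix.det_one, mul_one]; exact (isUnit_iff_ne_zero.2 h2k).pow _
  rw [e, Matrix.rank_mul_eq_right_of_isUnit_det _ _ h2det]

/-! ## §3 Where the nilpotency comes from: `charpoly A = charpoly W` with `W ≡ 0`; nilpotent matrices have small rank -/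

/-- **`charpoly A = charpoly W`, `W ≡ 0 (mod 𝔪)` ⇒ `(red A)^n = 0`** (both integral): the common characteristic polynomial descends to `𝒪`, its reduction is `charpoly(red W) = charpoly 0 = T^n`,
and Cayley–Hamilton. [cite: Kottwitz1986, §3] [cite: Serre1980Trees, Ch. II §1.1–1.2] -/
theorem pow_card_redMat_eq_zero_of_charpoly_eq {A W : Matrix (Fin n) (Fin n) F} (hA : ValBound 1 A) (hW : ValBound 1 W) (hWlt : ∀ i j, valuation F (W i j) < 1)
    (h : A.charpoly = W.charpoly) : redMat A ^ n = 0 := by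
  obtain ⟨A₀, rfl⟩ := exists_mapMatrix_eq_of_valBound_one hA
  obtain ⟨W₀, rfl⟩ := exists_mapMatrix_eq_of_valBound_one hW
  -- the characteristic polynomials over `𝒪` agree (the map `𝒪[T] → F[T]` is injective)
  have h0 : A₀.charpoly = W₀.charpoly := by
    apply Polynomial.map_injective (𝒪[F]).subtype Subtype.val_injective
    rw [← Matrix.charpoly_map, ← Matrix.charpoly_map]
    exact h
  -- `red W = 0`
  have hW0 : redMat ((𝒪[F]).subtype.mapMatrix W₀) = 0 :=
    (redMat_eq_zero_iff_forall_valuation_lt_one hW).2 hWlt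
  -- Cayley–Hamilton for `red A`, whose characteristic polynomial is `T^n`
  have hchar : (redMat ((𝒪[F]).subtype.mapMatrix A₀)).charpoly = Polynomial.X ^ n := by
    rw [redMat_mapMatrix, RingHom.mapMatrix_apply, Matrix.charpoly_map, h0, ← Matrix.charpoly_map, ← RingHom.mapMatrix_apply, ← redMat_mapMatrix, hW0,
      Matrix.charpoly_zero, Fintype.card_fin]
  have hCH := Matrix.aeval_self_charpoly (redMat ((𝒪[F]).subtype.mapMatrix A₀))
  rwa [hchar, Polynomial.aeval_X_pow] at hCH

/-- A nilpotent square matrix over a field on a non-trivial index type is NOT of full rank. [cite: Rogawski1990, §3.9 p. 32] -/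
theorem rank_lt_of_pow_eq_zero {k : Type*} [Field k] {N : Matrix (Fin n) (Fin n) k} {m : ℕ} (hN : N ^ m = 0) (hn : 0 < n) : N.rank < n := by
  by_contra hlt
  have hle : N.rank ≤ n := (Matrix.rank_le_width N)
  have heq : N.rank = n := le_antisymm hle (not_lt.1 hlt)
  -- full rank ⇒ `mulVecLin N` injective ⇒ so is its `m`-th power; but `N^m = 0`
  have hker : LinearMap.ker N.mulVecLin = ⊥ := by
    have h := LinearMap.finrank_range_add_finrank_ker N.mulVecLin
    rw [Module.finrank_fin_fun] at h
    have hr : Module.finrank k (LinearMap.range N.mulVecLin) = n := heq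
    have hk : Module.finrank k (LinearMap.ker N.mulVecLin) = 0 := by omega
    exact Submodule.finrank_eq_zero.1 hk
  have hinj : Function.Injective N.mulVecLin := LinearMap.ker_eq_bot.1 hker
  have hinjm : ∀ j : ℕ, Function.Injective (N ^ j).mulVecLin := by
    intro j
    induction j with
    | zero => rw [pow_zero, Matrix.mulVecLin_one]; exact fun a b h => h
    | succ j ih => rw [pow_succ, Matrix.mulVecLin_mul, LinearMap.coe_comp]; exact ih.comp hinj
  have h0 := hinjm m
  rw [hN, Matrix.mulVecLin_zero] at h0
  obtain ⟨i⟩ : Nonempty (Fin n) := ⟨⟨0, hn⟩⟩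
  have h01 : (Pi.single i (1 : k) : Fin n → k) = 0 := h0 (by simp)
  have h1 : (1 : k) = 0 := by simpa using congr_fun h01 i
  exact one_ne_zero h1

end Literature.NumberTheory.Automorphic

end
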